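import Literature.NumberTheory.EllipticCurves.CasselsTatePairingSelmerTwo
import HarnessLib

/-!
# The Cassels–Tate PIN on the jump-one class (crux stmt-BirchSwinnertonDyer-20509 `RamifiedOffTYZOfFacts`, line `offtyz-v7`,
# LEAD cruxlead-20509 g21, cycle 22) — structural lemma (E) of the triage-passed idea `cassels-tate-entries` (item 23431)

HONEST FRAMING (cell `bsd-print-cf2`, route `PrintCf2`; `--supports stmt-BirchSwinnertonDyer-20509`; `def`-free, no `sorry`; the only
named fact entering is the HYPOTHESIS `casselsTate_pairing_levelKernel` of the typer's (U4) file, p775107, wherever a dichotomy is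
claimed — the kernel descriptions themselves are fact-free). BSD is not proved by any of this; no class is closed; 20509 / 23431 OPEN.

WHAT. The idea card `Cruxes/RamifiedJumpOneLevelTwoOfFacts/Ideas/cassels-tate-entries.md` (cf2-ref g23 TRIAGE-23431-r1: PASS; director
(573)(A)) reads the level-two bit of `𝓛(n)` through the Cassels–Tate form on `Sel₂(E_n)`; its structural lemma (E) is «on category D
(`#Sel₂(E_n) = 2⁵`, rank one) the form is either ZERO (`#Sel₄ = 2⁸`) or has kernel exactly the Mordell–Weil line (`#Sel₄ = 2⁶`, the PIN)».
The typer's (U4) landing (`exists_ctSelmer_two`: an alternating `C` on `selmerGroup W 2` whose left and right kernels are the image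
`R = [2]_* Sel₄(E/K)`; `exists_natCard_selmerTwo_quot_eq_pow`: `[Sel₂ : R] = 2^{2k}`) makes (E) provable; this file proves it.

* §1 (any elliptic curve over a number field, fact-free): `R = π₂⁻¹(2·Ш[4])` (`mem_range_selmerZSMul_two_iff`); hence for every
  pairing `C` with left kernel `R`: `⟨s, ·⟩ ≡ 0 ⟺ π₂ s ∈ 2·Ш[4]`; **PIN** — if `Ш[4] = Ш[2]` then `⟨s, ·⟩ ≡ 0 ⟺ π₂ s = 0 ⟺ s = κ₂(P)`
  for a rational point `P` (Kummer exactness), and conversely the PIN forces `Ш[4] = Ш[2]`; **ZERO** — `C ≡ 0 ⟺ Ш[2] ≤ 2·Ш[4]`.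
* §2 (any elliptic curve over a number field with `#Ш[2] = 4`, granted the CT fact): the DICHOTOMY `Ш[4] = Ш[2] ∨ Ш[2] ≤ 2·Ш[4]`
  (the index `[Ш[2] : 2Ш[4] ∩ Ш[2]] = [Sel₂ : R]` is a square dividing `4`).
* §3 = the companion file `PrintCf2RamifiedOffTYZCasselsTatePinJumpOne.lean` (`E_n`, `n` square-free, rank one, `#Sel₂(E_n) = 2⁵`):
  `#Sel₄(E_n) = 2⁶ ∨ #Sel₄(E_n) = 2⁸` granted the CT fact; `#Sel₄ = 2⁶ ⟺ Ш[4] = Ш[2] ⟺` PIN; `#Sel₄ = 2⁸ ⟺ Ш[2] ≤ 2Ш[4] ⟺ C ≡ 0`;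
  and the PIN on the C⁺ class of item 23431 by name (analytic rank one via GZK = conjunct 1 of `𝔅_ram`).

So on the jump-one class the hypothesis `#Sel₄(E_n) = 2⁶` of C⁺ is CONSUMED as: «the Cassels–Tate form on `Sel₂(E_n)` is non-zero and
its radical is `κ₂(E_n(ℚ))` — the `2³`-element image of the Mordell–Weil group» (p770682: any proof of C⁺ must use `#Sel₄`).
References: Cassels 1962 (Arithmetic IV); Milne, *ADT* I §6 (Lemma 6.17, Thm 6.13(a)); Morgan–Smith 2021 §1 (1.4)–(1.5), Thm 1.3/Ex 1.4;
Silverman *AEC* VIII §2, X §4 (Thm X.4.2).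
-/

noncomputable section

open scoped Classical

open WeierstrassCurve Literature.NumberTheory.EllipticCurves

set_option autoImplicit false

universe u

namespace Summit.BirchSwinnertonDyer.PrintCf2.CasselsTatePin

/-- Arithmetic side condition `4 ∣ 2·2` for `[2]_* : Sel₄ → Sel₂` (content-free helper). [folklore] -/
theorem four_dvd_two_mul_two : (4 : ℤ) ∣ 2 * 2 := by norm_num

/-! ## §1 Kernel descriptions (fact-free, any elliptic curve over a number field) -/

section General

variable {K : Type u} [Field K] [NumberField K] (W : WeierstrassCurve K) [W.IsElliptic]

/-- **`[2]_* Sel₄(E/K) = π₂⁻¹(2·Ш(E/K)[4])`**: a `2`-Selmer class `s` is the image of a `4`-Selmer class under `[2]_*` iff its image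
`π₂ s ∈ Ш(E/K)` is twice a class killed by `4`. (⟹: `π₂([2]_* z) = 2·π₄ z`; ⟸: lift `w = π₄ z₀`, then `s − [2]_* z₀` dies in `Ш`,
hence is `[2]_* z₁` by Kummer exactness.) [cite: SilvermanAEC2009, Thm. X.4.2(a) and VIII.§2] [cite: MorganSmith2021CTP, §1 (1.1)–(1.5)] -/
theorem mem_range_selmerZSMul_two_iff (s : selmerGroup W 2) :
    s ∈ (selmerZSMul W (d := 2) (n := 4) 2 four_dvd_two_mul_two).range ↔
      ∃ w : W.sha, (4 : ℤ) • w = 0 ∧ (2 : ℤ) • w = selmerToSha W 2 s := by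
  constructor
  · rintro ⟨z, rfl⟩
    exact ⟨selmerToSha W 4 z, zsmul_selmerToSha W 4 z, (selmerToSha_selmerZSMul W 2 _ z).symm⟩
  · rintro ⟨w, hw4, hw2⟩
    obtain ⟨z₀, hz₀⟩ := exists_selmerToSha_eq W (n := 4) (by norm_num) w hw4
    have hker : selmerToSha W 2 (s - selmerZSMul W (d := 2) (n := 4) 2 four_dvd_two_mul_two z₀) = 0 := by
      rw [map_sub, selmerToSha_selmerZSMul, hz₀, hw2, sub_self]
    obtain ⟨z₁, hz₁⟩ := exists_selmerZSMul_eq_of_selmerToSha_eq_zero W (d := 2) (n := 4) 2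
      (by norm_num) (by norm_num) _ hker
    exact ⟨z₁ + z₀, by rw [map_add, hz₁, sub_add_cancel]⟩

variable {T : Type*} [AddCommGroup T]

/-- **Kernel of the Cassels–Tate form on `Sel₂` = `π₂⁻¹(2·Ш[4])`**: for any pairing `C` on `Sel₂(E/K)` whose left kernel is
`[2]_* Sel₄(E/K)` (the shape delivered by `exists_ctSelmer_two`), `⟨s, t⟩ = 0` for all `t` iff `π₂ s = 2w` with `4w = 0`.
[cite: MorganSmith2021CTP, §1 (1.5), Thm. 1.3 with Ex. 1.4] [cite: MilneADT2006, Ch. I §6 Lemma 6.17] -/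
theorem forall_apply_eq_zero_iff_exists_sha (C : selmerGroup W 2 →+ selmerGroup W 2 →+ T)
    (hl : ∀ s, (∀ t, C s t = 0) ↔ s ∈ (selmerZSMul W (d := 2) (n := 4) 2 four_dvd_two_mul_two).range)
    (s : selmerGroup W 2) :
    (∀ t, C s t = 0) ↔ ∃ w : W.sha, (4 : ℤ) • w = 0 ∧ (2 : ℤ) • w = selmerToSha W 2 s :=
  (hl s).trans (mem_range_selmerZSMul_two_iff W s)

/-- **The PIN (kernel = `ker π₂`) when `Ш(E/K)[4] = Ш(E/K)[2]`**: if no class of `Ш` has order `4`, the radical of the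
Cassels–Tate form on `Sel₂(E/K)` is exactly the set of Selmer classes dying in `Ш`, i.e. (next lemma) the Kummer image of `E(K)`.
[cite: MilneADT2006, Ch. I §6 Lemma 6.17, Thm. 6.13(a)] [cite: MorganSmith2021CTP, Thm. 1.3] -/
theorem forall_apply_eq_zero_iff_selmerToSha_eq_zero (C : selmerGroup W 2 →+ selmerGroup W 2 →+ T)
    (hl : ∀ s, (∀ t, C s t = 0) ↔ s ∈ (selmerZSMul W (d := 2) (n := 4) 2 four_dvd_two_mul_two).range)
    (hexp : ∀ w : W.sha, (4 : ℤ) • w = 0 → (2 : ℤ) • w = 0) (s : selmerGroup W 2) :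
    (∀ t, C s t = 0) ↔ selmerToSha W 2 s = 0 := by
  rw [forall_apply_eq_zero_iff_exists_sha W C hl]
  constructor
  · rintro ⟨w, hw4, hw2⟩
    rw [← hw2]
    exact hexp w hw4
  · intro hs
    exact ⟨0, smul_zero _, by rw [smul_zero, hs]⟩

omit [W.IsElliptic] in
/-- **Kummer exactness at `Sel₂`**: a `2`-Selmer class dies in `Ш(E/K)` iff it is the Kummer class `κ₂(P)` of a rational point
(`hdiv` = the `2`-divisibility of `E(K̄)`, `zsmul_geomPoints_surjective_holds`). [cite: SilvermanAEC2009, VIII.§2 and Thm. X.4.2(a)] -/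
theorem selmerToSha_eq_zero_iff_exists_kummer
    (hdiv : ∀ P : geomPoints W, ∃ Q : geomPoints W, (2 : ℤ) • Q = P) (s : selmerGroup W 2) :
    selmerToSha W 2 s = 0 ↔ ∃ P : W.toAffine.Point, kummerMapTorsion W 2 hdiv P = (s : galH1Torsion W 2) := by
  constructor
  · intro hs
    have hs0 : torsionH1ToH1 W 2 (s : galH1Torsion W 2) = 0 := by
      simpa using congrArg Subtype.val hs
    obtain ⟨P, hP⟩ := mem_range_kummerMapTorsion_of_torsionH1ToH1_eq_zero W 2 hdiv _ hs0
    exact ⟨P, hP⟩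
  · rintro ⟨P, hP⟩
    apply Subtype.ext
    change torsionH1ToH1 W 2 (s : galH1Torsion W 2) = 0
    rw [← hP]
    exact torsionH1ToH1_kummerMapTorsion W 2 hdiv P

/-- **The PIN in Mordell–Weil form**: if `Ш(E/K)[4] = Ш(E/K)[2]`, the radical of the Cassels–Tate form on `Sel₂(E/K)` is the Kummer
image `κ₂(E(K)) ≅ E(K)/2E(K)`. [cite: MilneADT2006, Ch. I §6 Lemma 6.17, Thm. 6.13(a)] [cite: SilvermanAEC2009, Thm. X.4.2(a)] -/
theorem forall_apply_eq_zero_iff_exists_kummer (C : selmerGroup W 2 →+ selmerGroup W 2 →+ T)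
    (hl : ∀ s, (∀ t, C s t = 0) ↔ s ∈ (selmerZSMul W (d := 2) (n := 4) 2 four_dvd_two_mul_two).range)
    (hexp : ∀ w : W.sha, (4 : ℤ) • w = 0 → (2 : ℤ) • w = 0)
    (hdiv : ∀ P : geomPoints W, ∃ Q : geomPoints W, (2 : ℤ) • Q = P) (s : selmerGroup W 2) :
    (∀ t, C s t = 0) ↔ ∃ P : W.toAffine.Point, kummerMapTorsion W 2 hdiv P = (s : galH1Torsion W 2) :=
  (forall_apply_eq_zero_iff_selmerToSha_eq_zero W C hl hexp s).trans
    (selmerToSha_eq_zero_iff_exists_kummer W hdiv s)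

/-- **Converse of the PIN**: if the radical of the Cassels–Tate form on `Sel₂(E/K)` consists of classes dying in `Ш`, then `Ш(E/K)` has
no class of order `4` (`Ш[4] = Ш[2]`): for `4w = 0`, `2w ∈ Ш[2]` lifts to `s ∈ Sel₂` in the radical, so `2w = π₂ s = 0`.
[cite: MilneADT2006, Ch. I §6 Lemma 6.17] [cite: SilvermanAEC2009, Thm. X.4.2(a)] -/
theorem sha_four_le_two_of_pin (C : selmerGroup W 2 →+ selmerGroup W 2 →+ T)
    (hl : ∀ s, (∀ t, C s t = 0) ↔ s ∈ (selmerZSMul W (d := 2) (n := 4) 2 four_dvd_two_mul_two).range)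
    (hpin : ∀ s, (∀ t, C s t = 0) → selmerToSha W 2 s = 0) (w : W.sha) (hw : (4 : ℤ) • w = 0) :
    (2 : ℤ) • w = 0 := by
  have h2w : (2 : ℤ) • ((2 : ℤ) • w) = 0 := by
    rw [smul_smul]; exact hw
  obtain ⟨s, hs⟩ := exists_selmerToSha_eq W two_ne_zero ((2 : ℤ) • w) h2w
  have h := hpin s ((forall_apply_eq_zero_iff_exists_sha W C hl s).mpr ⟨w, hw, hs.symm⟩)
  rwa [hs] at h

/-- **ZERO form ⟺ `Ш[2] ≤ 2·Ш[4]`**: the Cassels–Tate form on `Sel₂(E/K)` vanishes identically iff every class of `Ш(E/K)[2]` is twice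
a class of `Ш(E/K)[4]` (`π₂` is onto `Ш[2]`). [cite: MilneADT2006, Ch. I §6 Lemma 6.17, Thm. 6.13(a)] [cite: MorganSmith2021CTP, §1 (1.5)] -/
theorem forall_forall_apply_eq_zero_iff (C : selmerGroup W 2 →+ selmerGroup W 2 →+ T)
    (hl : ∀ s, (∀ t, C s t = 0) ↔ s ∈ (selmerZSMul W (d := 2) (n := 4) 2 four_dvd_two_mul_two).range) :
    (∀ s t, C s t = 0) ↔ ∀ x : W.sha, (2 : ℤ) • x = 0 → ∃ w : W.sha, (4 : ℤ) • w = 0 ∧ (2 : ℤ) • w = x := by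
  constructor
  · intro h x hx
    obtain ⟨s, rfl⟩ := exists_selmerToSha_eq W two_ne_zero x hx
    exact (forall_apply_eq_zero_iff_exists_sha W C hl s).mp (h s)
  · intro h s
    exact (forall_apply_eq_zero_iff_exists_sha W C hl s).mpr (h _ (zsmul_selmerToSha W 2 s))

end General

/-! ## §2 The dichotomy for `#Ш[2] = 4` (granted the Cassels–Tate fact) -/

section Dichotomy

variable {K : Type u} [Field K] [NumberField K] (W : WeierstrassCurve K) [W.IsElliptic]

omit [W.IsElliptic] in
/-- Membership in `Ш(E/K)[n]` (unfolding `AddSubgroup.torsionBy`). [folklore] -/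
theorem mem_sha_torsionBy_iff (n : ℤ) (x : W.sha) :
    x ∈ AddSubgroup.torsionBy W.sha n ↔ n • x = 0 :=
  Submodule.mem_torsionBy_iff n x

/-- **DICHOTOMY** (granted `casselsTate_pairing_levelKernel K`): for an elliptic curve `E/K` with `#Ш(E/K)[2] = 4`, EITHER
`Ш(E/K)[4] = Ш(E/K)[2]` (no class of order `4`; the PIN regime) OR `Ш(E/K)[2] ≤ 2·Ш(E/K)[4]` (every `2`-torsion class halves;
the ZERO regime). Proof: the subgroup `D = 2Ш[4] ≤ Ш[2]` pulls back under the surjection `π₂ : Sel₂ ↠ Ш[2]` to `[2]_* Sel₄`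
(§1), so `[Ш[2] : D] = [Sel₂ : [2]_* Sel₄] = 2^{2k}` (`exists_natCard_selmerTwo_quot_eq_pow`, the non-degenerate alternating form
on the quotient) divides `4`: `k = 0` gives `D = Ш[2]`, `k = 1` gives `D = 0`. (On `𝔽₂²` an alternating form is `0` or perfect.)
[cite: MilneADT2006, Ch. I §6 Thm. 6.13(a), Lemma 6.17; Cor. 6.24] [cite: MorganSmith2021CTP, Thm. 1.3 with Ex. 1.4] [cite: Cassels1962ArithmeticIV] -/
theorem sha_dichotomy_of_natCard_sha_two_eq_four (hCT : casselsTate_pairing_levelKernel K)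
    (h4 : Nat.card (AddSubgroup.torsionBy W.sha (2 : ℤ)) = 4) :
    (∀ w : W.sha, (4 : ℤ) • w = 0 → (2 : ℤ) • w = 0) ∨
      (∀ x : W.sha, (2 : ℤ) • x = 0 → ∃ w : W.sha, (4 : ℤ) • w = 0 ∧ (2 : ℤ) • w = x) := by
  set S2 : AddSubgroup W.sha := AddSubgroup.torsionBy W.sha (2 : ℤ) with hS2
  haveI : Finite S2 := Nat.finite_of_card_ne_zero (by rw [h4]; norm_num)
  -- `D = 2·Ш[4]` seen inside `Ш[2]`
  let D : AddSubgroup S2 :=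
    { carrier := {x | ∃ w : W.sha, (4 : ℤ) • w = 0 ∧ (2 : ℤ) • w = (x : W.sha)}
      zero_mem' := ⟨0, smul_zero _, by rw [smul_zero]; rfl⟩
      add_mem' := by
        rintro x y ⟨w, hw4, hw2⟩ ⟨w', hw4', hw2'⟩
        exact ⟨w + w', by rw [smul_add, hw4, hw4', add_zero], by rw [smul_add, hw2, hw2']; rfl⟩
      neg_mem' := by
        rintro x ⟨w, hw4, hw2⟩
        exact ⟨-w, by rw [smul_neg, hw4, neg_zero], by rw [smul_neg, hw2]; rfl⟩ }
  have hD : ∀ x : S2, x ∈ D ↔ ∃ w : W.sha, (4 : ℤ) • w = 0 ∧ (2 : ℤ) • w = (x : W.sha) :=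
    fun x => Iff.rfl
  -- `f = π₂ : Sel₂ ↠ Ш[2]`
  let f : selmerGroup W 2 →+ S2 := (selmerToSha W 2).codRestrict S2 fun s =>
    (mem_sha_torsionBy_iff W 2 _).mpr (zsmul_selmerToSha W 2 s)
  have hf : ∀ s, ((f s : S2) : W.sha) = selmerToSha W 2 s := fun s => rfl
  have hfsurj : Function.Surjective f := by
    intro x
    obtain ⟨s, hs⟩ := exists_selmerToSha_eq W two_ne_zero (x : W.sha)
      ((mem_sha_torsionBy_iff W 2 _).mp x.2)
    exact ⟨s, Subtype.ext (by rw [hf, hs])⟩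
  -- `[2]_* Sel₄ = f⁻¹(D)`
  have hR : (selmerZSMul W (d := 2) (n := 4) 2 four_dvd_two_mul_two).range = D.comap f := by
    ext s
    rw [mem_range_selmerZSMul_two_iff, AddSubgroup.mem_comap, hD, hf]
  -- index transport: `[Ш[2] : D] = [Sel₂ : [2]_* Sel₄] = 2^{2k}`
  obtain ⟨k, hk⟩ := exists_natCard_selmerTwo_quot_eq_pow hCT W
  have hidx : D.index = 2 ^ (2 * k) := by
    rw [← AddSubgroup.index_comap_of_surjective D hfsurj, ← hR, AddSubgroup.index_eq_card]
    exact hk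
  have hdvd : D.index ∣ 4 := h4 ▸ D.index_dvd_card
  have hk1 : k = 0 ∨ k = 1 := by
    rw [hidx, show (4 : ℕ) = 2 ^ 2 by norm_num, Nat.pow_dvd_pow_iff_le_right (by norm_num)] at hdvd
    omega
  rcases hk1 with rfl | rfl
  · -- index 1: `D = Ш[2]`, the ZERO regime
    right
    have htop : D = ⊤ := AddSubgroup.index_eq_one.mp (by simpa using hidx)
    intro x hx
    have hxD : (⟨x, (mem_sha_torsionBy_iff W 2 x).mpr hx⟩ : S2) ∈ D := by
      rw [htop]; exact AddSubgroup.mem_top _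
    exact (hD _).mp hxD
  · -- index 4 = #Ш[2]: `D = 0`, the PIN regime
    left
    have hcard : Nat.card D = 1 := by
      have h := D.card_mul_index
      rw [hidx, h4, show (2 : ℕ) ^ (2 * 1) = 4 by norm_num] at h
      exact Nat.eq_of_mul_eq_mul_right (by norm_num : 0 < 4) (h.trans (one_mul 4).symm)
    have hbot : D = ⊥ := AddSubgroup.eq_bot_of_card_le D (by rw [hcard])
    intro w hw
    have h2w : (2 : ℤ) • ((2 : ℤ) • w) = 0 := by
      rw [smul_smul]; exact hw
    have hmem : (⟨(2 : ℤ) • w, (mem_sha_torsionBy_iff W 2 _).mpr h2w⟩ : S2) ∈ D :=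
      (hD _).mpr ⟨w, hw, rfl⟩
    rw [hbot, AddSubgroup.mem_bot] at hmem
    exact congrArg Subtype.val hmem

/-- **DICHOTOMY, pairing form**: granted the CT fact, for `#Ш(E/K)[2] = 4` and any pairing `C` on `Sel₂(E/K)` with left kernel
`[2]_* Sel₄(E/K)`: EITHER the radical of `C` is `ker π₂` (PIN) OR `C ≡ 0`. [cite: MilneADT2006, Ch. I §6 Thm. 6.13(a), Lemma 6.17]
[cite: MorganSmith2021CTP, Thm. 1.3 with Ex. 1.4] -/
theorem pin_or_zero_of_natCard_sha_two_eq_four {T : Type*} [AddCommGroup T]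
    (hCT : casselsTate_pairing_levelKernel K) (h4 : Nat.card (AddSubgroup.torsionBy W.sha (2 : ℤ)) = 4)
    (C : selmerGroup W 2 →+ selmerGroup W 2 →+ T)
    (hl : ∀ s, (∀ t, C s t = 0) ↔ s ∈ (selmerZSMul W (d := 2) (n := 4) 2 four_dvd_two_mul_two).range) :
    (∀ s, (∀ t, C s t = 0) ↔ selmerToSha W 2 s = 0) ∨ (∀ s t, C s t = 0) := by
  rcases sha_dichotomy_of_natCard_sha_two_eq_four W hCT h4 with hexp | hdiv
  · exact Or.inl (forall_apply_eq_zero_iff_selmerToSha_eq_zero W C hl hexp)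
  · exact Or.inr ((forall_forall_apply_eq_zero_iff W C hl).mpr hdiv)

omit [W.IsElliptic] in
/-- **The two regimes are exclusive when `Ш[2] ≠ 0`**: `Ш[4] = Ш[2]` and `Ш[2] ≤ 2Ш[4]` together force `Ш[2] = 0`.
[folklore] -/
theorem sha_two_eq_zero_of_both (hexp : ∀ w : W.sha, (4 : ℤ) • w = 0 → (2 : ℤ) • w = 0)
    (hdiv : ∀ x : W.sha, (2 : ℤ) • x = 0 → ∃ w : W.sha, (4 : ℤ) • w = 0 ∧ (2 : ℤ) • w = x)
    (x : W.sha) (hx : (2 : ℤ) • x = 0) : x = 0 := by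
  obtain ⟨w, hw4, rfl⟩ := hdiv x hx
  exact hexp w hw4

end Dichotomy

end Summit.BirchSwinnertonDyer.PrintCf2.CasselsTatePin

end
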